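import Summits.QuantumFields.BalabanUV.Beta.CombHId2TorusRecord

/-!
# `BalabanUV.Beta.CombHId2TorusTwin` — binder row D1 (OWNER an2), (J-a) dictionary, (C2) at ORDER 2, PART THREE (letters, 2d): **TWO OF leaf-05's FOUR BLOCK LETTERS
# FOR J2, AT an1's RECORD** — the first jet `D̂_b := perF M (dM G Lc S^per_j M^per_j b)` has NO multiplier–multiplier block (L1a) and its border is the SYMMETRIC
# twin (L2a): `D̂_b((x̄, inr m),(z̄, inl α)) = D̂_b((z̄, inl α),(x̄, inr m))`; THE SAME TWO LETTERS FOR THE RESPONSE WORD `Ẑ_{bb′}` (L1c)∕(L2c)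

WHY.  leaf-05's J2 (`FP/CoarseJetOrderTwoGradedCombJunctionRecord`, I-leaf05-g35-5) reads the door's jets off the lattice side's torus matrices and needs four block
letters (PROPOSED-8 l.51672): (L1) `D̂∘(fμ,fμ) = 0`, `Ŵ∘(fμ,fμ) = 0`; (L2) `D̂∘(f,fμ) = (D̂∘(fμ,f))ᵀ`, `Ŵ∘(f,fμ) = −(Ŵ∘(fμ,f))ᵀ`.  This file types (L1a) and (L2a)
for the FIRST jet at an1's record `tabs := symTablesAn1S2 d Lc cΛ′` (generic `d`): every first-order table the word reads is `mm`-free and border-SYMMETRIC —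
`StepJetData.wilsonA` (field block only), an1's packer `AveragingHessianKernels.packVH` behind `symVhSAt` («the symmetric twin on `(inr, inl)`»), the `mmRead`-placed
chain part `e3OfK` (field block only), `M1Of (symHessFFAt …)` (field block only) — and `dM K′` weights them by SCALARS (any weight kernel `K′`; the lattice
statement behind `SpineRecursiveParity.parityOdd_dM`).  (L1b)∕(L2b) for the assembled `Ŵ` are NOT typed here: W-an2-g45-9 (l.51694) records why (L2b) is a located
obstruction candidate term by term (the response word is border-symmetric, the `T2` slot `atw`-antisymmetric).
WHAT ([folklore]; 0 `def`, 0 cited fact, 0 `def … : Prop`, 0 sorry): §1 generic torus letters `perF_eq_zero_of_entries`, `perF_twin_of_twin` (period-invariant `X`);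
§2 lattice letters `dper_entry_eq_zero`, `dper_twin_of_twin`, `dM_entry_eq_zero_of_tables`, `dM_twin_of_tables` (ANY weight kernel); §3 at an1's record:
`wilsonA_inr`, `wilsonA_right_inr`, `symVhSAt_inr`, `symVhSAt_twin` (= an1's `symVhSAt_symm`), `SpureCombOf_an1_inr`, `SpureCombOf_an1_twin` (an1's `symHessFFAt_inr ∕ _inl_inr` BY NAME),
`tabsM_an1_right_inr ∕ _left_inr`, **`perF_dM_comb_an1_inr_inr`** (L1a), **`perF_dM_comb_an1_twin`** (L2a); §4 the same two letters for the RESPONSE word `Ẑ_{bb′} := dM (K2OfK G … b′) … b` (leaf-05 W-11, `K′ := K2OfK`): **`perF_resp_comb_an1_inr_inr`** (L1c), **`perF_resp_comb_an1_twin`** (L2c); §5 (L0) **`perF_GcombSh_border_antitwin`** — `Â`'s border is the ANTI-twin (leaf-05's (P0) `Θᴸ = −Θᵀ`: `CombChartWardSockets.trK_GcombSh` + `translate_inv_GcombSh`), with the generic `perF_antitwin_of_antitwin`.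
NOT HERE: (L1b)∕(L2b); the torus algebra (leaf-05's J1∕J2); nothing of Bałaban's asserted; NOT D1, NEVER «G-an2-4 closed», NOT BetaPertH, NOT continuum, NOT Clay.

HONEST DEPENDENCY (page 1, mandatory): continuum YM on T⁴ ⇐ BetaPertH ∧ nine spine estimates (0/9 proved); BetaPertH ⇐ (D1) ∧ (D4) ∧ CAP+tail;
G-an2-4 gates asym, D1 and NE2/3/4.  HONEST FRAMING (cell contract, verbatim): «discharging `BetaPertH` makes Bałaban's UV stability UNCONDITIONAL —
a real constructive-QFT result; it is NOT the continuum limit and NOT the Clay problem.»  ABSOLUTE RULE (cell charter, verbatim): «No internally-minted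
statement may enter as a cited fact. Every hypothesis is either kernel-proved in this package or a verbatim quotation of a PUBLISHED theorem with page
reference. The manuscript(s) under audit are NOT citable for their own disputed steps — they are the thing under adjudication; programme-internal
(2001/route/tribunal) claims are never citable.»  Row D1 OWNER an2 (b2b-balaban-beta-an2) gen 45, 2026-08-23; over `CombHId2TorusRecord` and the record's packers BY NAME.
-/

noncomputable section

open scoped BigOperators Matrix

namespace Summit.QuantumFields.BalabanUV.Beta.CombHId2TorusTwin

open Literature.MathematicalPhysics.QuantumFieldTheory.Balaban1983to89
open Literature.MathematicalPhysics.QuantumFieldTheory.Balaban1983to89.Beta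
open B4TorusKernel.MultiPeriod (translate)
open ExpKernelCalculus (MKer)
open AffineAveraging (Site)
open OneStepResolventKernel (Fib)
open SecondOrderResponse (vertexOfM dM dM_apply K2OfK)
open OneStepKernelFamily (vertexOfK)
open StepJetData (wilsonA)
open BalabanStepJetsSucc (mmRead mmRead_inr_left mmRead_inr_right)
open InterLevelTransport (cwsum_apply)
open Summit.QuantumFields.BalabanUV.Beta.SpineRooted (e3OfK e3OfK_apply SpureRecOf SpureRecOf_zero_level SpureRecOf_succ M1Of M1Of_apply)
open Summit.QuantumFields.BalabanUV.Beta.FP.KernelPeriodisationFib (perF perZ perF_apply perZ_apply)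
open Summit.QuantumFields.BalabanUV.Beta.FP.KernelPeriodisationFibLoc (dper dper_apply)
open Summit.QuantumFields.BalabanUV.Beta.SymAveragingHessianCounts (symVhSAt symHessFFAt symVhSAt_symm symHessFFAt_inr symHessFFAt_inl_inr)
open AveragingContoursRooted (ctr)
open Summit.QuantumFields.BalabanUV.Beta.SymSecondOrderTablesAn1 (symTablesAn1S2 symTablesAn1S2_V symTablesAn1S2_M)
open Summit.QuantumFields.BalabanUV.Beta.CombChartStepJets (GcombSh SpureCombOf locStencil_SpureCombOf decays_GcombSh)
open Summit.QuantumFields.BalabanUV.Beta.CombChartWardSockets (trK_GcombSh)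
open Summit.QuantumFields.BalabanUV.Beta.TameKernelCalculus (trK trK_apply)
open Summit.QuantumFields.BalabanUV.Beta.BorderedHessian (sgnK sgnK_apply sgnF sgnF_inl sgnF_inr)
open B6Lemma24Torus (pbox)
open Summit.QuantumFields.BalabanUV.Beta.CombHId1Letters (vertexOfK_apply perZ_eq_tsum_translate_left)
open Summit.QuantumFields.BalabanUV.Beta.CombHId2Record (periodCov_SpureCombOf periodCov_tabsM translate_inv_GcombSh)
open Summit.QuantumFields.BalabanUV.Beta.CombHId2Torus (dM_dper_translate_inv)
open Summit.QuantumFields.BalabanUV.Beta.CombHId2TorusWords (K2OfK_dper_translate_inv exists_decays_K2OfK_dper)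

variable {d : ℕ} (M : Fin (d + 1) → ℕ) [∀ μ, NeZero (M μ)]

/-! ## §1 Generic torus letters: vanishing blocks and twin symmetry pass to `perF` -/

omit [∀ μ, NeZero (M μ)] in
/-- [folklore] a block of entries vanishing on the lattice vanishes on the torus. -/
theorem perF_eq_zero_of_entries {X : MKer (d + 1) (Fib d)} {a b : Fib d} (h : ∀ x z : Site (d + 1), X x z a b = 0) (xbar zbar : ↥(pbox M)) :
    perF M X (xbar, a) (zbar, b) = 0 := by
  simp only [perF_apply, perZ_apply, h, tsum_zero]

omit [∀ μ, NeZero (M μ)] in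
/-- [folklore] **TWIN SYMMETRY PASSES TO THE TORUS**: for `X` invariant under the period lattice with `X x z a b = X z x b a` on the lattice,
`perF M X ((x̄, a),(z̄, b)) = perF M X ((z̄, b),(x̄, a))` (C2a `perZ_eq_tsum_translate_left`). -/
theorem perF_twin_of_twin {X : MKer (d + 1) (Fib d)}
    (hXinv : ∀ (m x z : Site (d + 1)) (a b : Fib d), X (translate M x m) (translate M z m) a b = X x z a b)
    {a b : Fib d} (h : ∀ x z : Site (d + 1), X x z a b = X z x b a) (xbar zbar : ↥(pbox M)) :
    perF M X (xbar, a) (zbar, b) = perF M X (zbar, b) (xbar, a) := by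
  rw [perF_apply, perF_apply, perZ_apply, perZ_eq_tsum_translate_left M hXinv]
  exact tsum_congr fun n => h _ _

omit [∀ μ, NeZero (M μ)] in
/-- [folklore] **ANTI-TWIN SYMMETRY PASSES TO THE TORUS**: for `X` invariant under the period lattice with `X x z a b = −X z x b a` on the lattice,
`perF M X ((x̄, a),(z̄, b)) = −perF M X ((z̄, b),(x̄, a))`. -/
theorem perF_antitwin_of_antitwin {X : MKer (d + 1) (Fib d)}
    (hXinv : ∀ (m x z : Site (d + 1)) (a b : Fib d), X (translate M x m) (translate M z m) a b = X x z a b)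
    {a b : Fib d} (h : ∀ x z : Site (d + 1), X x z a b = -X z x b a) (xbar zbar : ↥(pbox M)) :
    perF M X (xbar, a) (zbar, b) = -perF M X (zbar, b) (xbar, a) := by
  rw [perF_apply, perF_apply, perZ_apply, perZ_eq_tsum_translate_left M hXinv, ← tsum_neg]
  exact tsum_congr fun n => h _ _

/-! ## §2 Lattice letters: vanishing blocks and twin symmetry pass through `dper` and through `dM` (any weight kernel) -/

omit [∀ μ, NeZero (M μ)] in
/-- [folklore] `dper` preserves a vanishing block. -/
theorem dper_entry_eq_zero {X : MKer (d + 1) (Fib d)} {a b : Fib d} (h : ∀ x z : Site (d + 1), X x z a b = 0) (x z : Site (d + 1)) :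
    dper M X x z a b = 0 := by
  simp only [dper_apply, h, tsum_zero]

omit [∀ μ, NeZero (M μ)] in
/-- [folklore] `dper` preserves twin symmetry. -/
theorem dper_twin_of_twin {X : MKer (d + 1) (Fib d)} {a b : Fib d} (h : ∀ x z : Site (d + 1), X x z a b = X z x b a) (x z : Site (d + 1)) :
    dper M X x z a b = dper M X z x b a := by
  simp only [dper_apply]
  exact tsum_congr fun n => h _ _

/-- [folklore] **the background derivative of `mm`-free tables is `mm`-free, FOR ANY WEIGHT KERNEL** (the column weights are scalars). -/
theorem dM_entry_eq_zero_of_tables (K' : MKer (d + 1) (Fib d)) (N : ℕ) [NeZero N] {S Mt : Fin (d + 1) → Site (d + 1) → MKer (d + 1) (Fib d)} {a b : Fib d}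
    (hS : ∀ (κ : Fin (d + 1)) (u x z : Site (d + 1)), S κ u x z a b = 0) (hMt : ∀ (ρ : Fin (d + 1)) (w x z : Site (d + 1)), Mt ρ w x z a b = 0)
    (μ : Fin (d + 1)) (y x z : Site (d + 1)) : dM K' N S Mt μ y x z a b = 0 := by
  rw [dM_apply, vertexOfK_apply]
  unfold SecondOrderResponse.vertexOfM
  simp only [cwsum_apply, hS, hMt, mul_zero, tsum_zero, Finset.sum_const_zero, add_zero]

/-- [folklore] **the background derivative of twin-symmetric tables is twin-symmetric, FOR ANY WEIGHT KERNEL**. -/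
theorem dM_twin_of_tables (K' : MKer (d + 1) (Fib d)) (N : ℕ) [NeZero N] {S Mt : Fin (d + 1) → Site (d + 1) → MKer (d + 1) (Fib d)} {a b : Fib d}
    (hS : ∀ (κ : Fin (d + 1)) (u x z : Site (d + 1)), S κ u x z a b = S κ u z x b a)
    (hMt : ∀ (ρ : Fin (d + 1)) (w x z : Site (d + 1)), Mt ρ w x z a b = Mt ρ w z x b a)
    (μ : Fin (d + 1)) (y x z : Site (d + 1)) : dM K' N S Mt μ y x z a b = dM K' N S Mt μ y z x b a := by
  rw [dM_apply, dM_apply, vertexOfK_apply, vertexOfK_apply]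
  unfold SecondOrderResponse.vertexOfM
  simp only [cwsum_apply, hS, hMt]

/-! ## §3 At an1's record: the first-order tables are `mm`-free and border-symmetric; hence so is `D̂_b` -/

section Record

variable {Lc : ℕ} [NeZero Lc] {M' : Fin (d + 1) → ℕ} (cΛ' cE cVH cΛ : ℝ)

omit [∀ μ, NeZero (M μ)] [NeZero Lc] in
/-- [folklore] `wilsonA` has no entry with a multiplier leg on the left. -/
theorem wilsonA_inr (κ : Fin (d + 1)) (u x z : Site (d + 1)) (m : Fin (d + 1)) (b : Fib d) : wilsonA d κ u x z (Sum.inr m) b = 0 := by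
  cases b <;> rfl

omit [∀ μ, NeZero (M μ)] [NeZero Lc] in
/-- [folklore] `wilsonA` has no entry with a multiplier leg on the right (an3's `WilsonReflectionContact.wilsonA_inl_inr ∕ _inr_inr` are the two cases; stated
here for any left leg to keep this module's imports at one). -/
theorem wilsonA_right_inr (κ : Fin (d + 1)) (u x z : Site (d + 1)) (a : Fib d) (m : Fin (d + 1)) : wilsonA d κ u x z a (Sum.inr m) = 0 := by
  cases a <;> rfl

omit [∀ μ, NeZero (M μ)] [NeZero Lc] in
/-- [folklore] `symVhSAt` (an1's `packVH` packing) has no multiplier–multiplier entry. -/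
theorem symVhSAt_inr (L : ℕ) (κ : Fin (d + 1)) (u x z : Site (d + 1)) (m m' : Fin (d + 1)) :
    symVhSAt (ctr (d + 1) L) d L rfl κ u x z (Sum.inr m) (Sum.inr m') = 0 := rfl

omit [∀ μ, NeZero (M μ)] [NeZero Lc] in
/-- [folklore] **`packVH`'s SYMMETRIC twin** on the border: `symVhSAt … x z (inr m) (inl α) = symVhSAt … z x (inl α) (inr m)` (an1's `SymAveragingHessianCounts.symVhSAt_symm` = `packVH_symm`, BY NAME). -/
theorem symVhSAt_twin (L : ℕ) (κ : Fin (d + 1)) (u x z : Site (d + 1)) (α m : Fin (d + 1)) :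
    symVhSAt (ctr (d + 1) L) d L rfl κ u x z (Sum.inr m) (Sum.inl α) = symVhSAt (ctr (d + 1) L) d L rfl κ u z x (Sum.inl α) (Sum.inr m) :=
  symVhSAt_symm _ L κ u x z _ _

omit [∀ μ, NeZero (M μ)] in
/-- [folklore] at an1's record the multiplier tables `M_j = M1Of (symHessFFAt ρ_c Lc) cΛ′ j` have no entry with a multiplier leg on the right (an1's `symHessFFAt_inl_inr ∕ _inr`). -/
theorem tabsM_an1_right_inr (j : ℕ) (ρ : Fin (d + 1)) (w x z : Site (d + 1)) (a : Fib d) (m : Fin (d + 1)) :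
    (symTablesAn1S2 d Lc cΛ').M j ρ w x z a (Sum.inr m) = 0 := by
  cases a <;> simp only [symTablesAn1S2_M, M1Of_apply, Pi.smul_apply, smul_eq_mul, symHessFFAt_inl_inr, symHessFFAt_inr, mul_zero]

omit [∀ μ, NeZero (M μ)] in
/-- [folklore] … and none with a multiplier leg on the left (an1's `symHessFFAt_inr`). -/
theorem tabsM_an1_left_inr (j : ℕ) (ρ : Fin (d + 1)) (w x z : Site (d + 1)) (m : Fin (d + 1)) (b : Fib d) :
    (symTablesAn1S2 d Lc cΛ').M j ρ w x z (Sum.inr m) b = 0 := by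
  simp only [symTablesAn1S2_M, M1Of_apply, Pi.smul_apply, smul_eq_mul, symHessFFAt_inr, mul_zero]

omit [∀ μ, NeZero (M μ)] in
/-- [folklore] at an1's record the level-`j` first-order field table has no entry with a multiplier leg on the left and a multiplier leg on the right. -/
theorem SpureCombOf_an1_inr (j : ℕ) (κ : Fin (d + 1)) (u x z : Site (d + 1)) (m m' : Fin (d + 1)) :
    SpureCombOf (symTablesAn1S2 d Lc cΛ') cE cVH cΛ j κ u x z (Sum.inr m) (Sum.inr m') = 0 := by
  cases j with
  | zero =>
    simp only [SpureCombOf, SpureRecOf_zero_level, symTablesAn1S2_V, Pi.add_apply, Pi.smul_apply, smul_eq_mul, wilsonA_inr, symVhSAt_inr,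
      mul_zero, add_zero]
  | succ j =>
    simp only [SpureCombOf, SpureRecOf_succ, symTablesAn1S2_V, Pi.add_apply, Pi.smul_apply, smul_eq_mul, e3OfK_apply, mmRead_inr_left, neg_zero,
      symVhSAt_inr, mul_zero, add_zero]

omit [∀ μ, NeZero (M μ)] in
/-- [folklore] … and no field–multiplier entry from the Wilson∕chain sectors: only the border `V` contributes, symmetrically. -/
theorem SpureCombOf_an1_twin (j : ℕ) (κ : Fin (d + 1)) (u x z : Site (d + 1)) (α m : Fin (d + 1)) :
    SpureCombOf (symTablesAn1S2 d Lc cΛ') cE cVH cΛ j κ u x z (Sum.inr m) (Sum.inl α)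
      = SpureCombOf (symTablesAn1S2 d Lc cΛ') cE cVH cΛ j κ u z x (Sum.inl α) (Sum.inr m) := by
  cases j with
  | zero =>
    simp only [SpureCombOf, SpureRecOf_zero_level, symTablesAn1S2_V, Pi.add_apply, Pi.smul_apply, smul_eq_mul, wilsonA_inr, wilsonA_right_inr,
      symVhSAt_twin]
  | succ j =>
    simp only [SpureCombOf, SpureRecOf_succ, symTablesAn1S2_V, Pi.add_apply, Pi.smul_apply, smul_eq_mul, e3OfK_apply, mmRead_inr_left,
      mmRead_inr_right, symVhSAt_twin]

omit [∀ μ, NeZero (M μ)] in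
/-- [folklore] **(L1a) AT an1's RECORD — THE FIRST JET HAS NO MULTIPLIER–MULTIPLIER BLOCK**: `D̂_b((x̄, inr m),(z̄, inr m′)) = 0`,
`D̂_b := perF M (dM (GcombSh Lc j) Lc S^per_j M^per_j b)` at `tabs := symTablesAn1S2 d Lc cΛ′`. -/
theorem perF_dM_comb_an1_inr_inr (j : ℕ) (μ : Fin (d + 1)) (y : Site (d + 1)) (xbar zbar : ↥(pbox M)) (m m' : Fin (d + 1)) :
    perF M (dM (GcombSh (d := d) Lc j) Lc (fun κ u => dper M (SpureCombOf (symTablesAn1S2 d Lc cΛ') cE cVH cΛ j κ u))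
        (fun ρ w => dper M ((symTablesAn1S2 d Lc cΛ').M j ρ w)) μ y) (xbar, Sum.inr m) (zbar, Sum.inr m') = 0 :=
  perF_eq_zero_of_entries M (fun x z => dM_entry_eq_zero_of_tables _ _
    (fun κ u x z => dper_entry_eq_zero M (fun x z => SpureCombOf_an1_inr cΛ' cE cVH cΛ j κ u x z m m') x z)
    (fun ρ w x z => dper_entry_eq_zero M (fun x z => tabsM_an1_left_inr cΛ' j ρ w x z m _) x z) μ y x z) xbar zbar

/-- [folklore] **(L2a) AT an1's RECORD — THE FIRST JET's BORDER IS THE SYMMETRIC TWIN**: `D̂_b((x̄, inr m),(z̄, inl α)) = D̂_b((z̄, inl α),(x̄, inr m))`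
(`M = Lc·M′`; period invariance of `D̂_b`'s kernel: `CombHId2Torus.dM_dper_translate_inv` with the record's letters; twin symmetry of the tables: §3 above). -/
theorem perF_dM_comb_an1_twin (hM : ∀ i, M i = Lc * M' i) (j : ℕ) (μ : Fin (d + 1)) (y : Site (d + 1)) (xbar zbar : ↥(pbox M)) (α m : Fin (d + 1)) :
    perF M (dM (GcombSh (d := d) Lc j) Lc (fun κ u => dper M (SpureCombOf (symTablesAn1S2 d Lc cΛ') cE cVH cΛ j κ u))
        (fun ρ w => dper M ((symTablesAn1S2 d Lc cΛ').M j ρ w)) μ y) (xbar, Sum.inr m) (zbar, Sum.inl α)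
      = perF M (dM (GcombSh (d := d) Lc j) Lc (fun κ u => dper M (SpureCombOf (symTablesAn1S2 d Lc cΛ') cE cVH cΛ j κ u))
        (fun ρ w => dper M ((symTablesAn1S2 d Lc cΛ').M j ρ w)) μ y) (zbar, Sum.inl α) (xbar, Sum.inr m) := by
  have hLM : ∀ i, Lc ∣ M i := fun i => ⟨M' i, hM i⟩
  obtain ⟨δG, CG, hδG, -, hG⟩ := decays_GcombSh (d := d) (Lc := Lc) j
  obtain ⟨CS, δS, hδS, hS⟩ := locStencil_SpureCombOf (symTablesAn1S2 d Lc cΛ') cE cVH cΛ j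
  obtain ⟨CM, δM, hδM, hMloc⟩ := (symTablesAn1S2 d Lc cΛ').hM j
  have hXinv := dM_dper_translate_inv M hM (translate_inv_GcombSh M hLM j) hG hδG (periodCov_SpureCombOf M (symTablesAn1S2 d Lc cΛ') cE cVH cΛ hLM j) hS hδS
    (periodCov_tabsM M (symTablesAn1S2 d Lc cΛ') hM j) hMloc hδM μ y
  refine perF_twin_of_twin M hXinv (fun x z => ?_) xbar zbar
  refine dM_twin_of_tables _ _ (fun κ u x z => dper_twin_of_twin M (fun x z => SpureCombOf_an1_twin cΛ' cE cVH cΛ j κ u x z α m) x z)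
    (fun ρ w x z => ?_) μ y x z
  rw [dper_entry_eq_zero M (fun x z => tabsM_an1_left_inr cΛ' j ρ w x z m _) x z, dper_entry_eq_zero M (fun x z => tabsM_an1_right_inr cΛ' j ρ w x z _ m) z x]

/-! ## §4 The same two letters for the RESPONSE word `Ẑ_{b b′} := dM (K2OfK G Lc S^per M^per b′) Lc S^per M^per b` (leaf-05 W-11: `K′ := K2OfK …`) -/

omit [∀ μ, NeZero (M μ)] in
/-- [folklore] **(L1c) AT an1's RECORD — THE RESPONSE WORD HAS NO MULTIPLIER–MULTIPLIER BLOCK** (any weight kernel: here `K′ := K2OfK (GcombSh Lc j) …`). -/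
theorem perF_resp_comb_an1_inr_inr (j : ℕ) (μ : Fin (d + 1)) (y : Site (d + 1)) (ν : Fin (d + 1)) (y' : Site (d + 1)) (xbar zbar : ↥(pbox M))
    (m m' : Fin (d + 1)) :
    perF M (dM (K2OfK (GcombSh (d := d) Lc j) Lc (fun κ u => dper M (SpureCombOf (symTablesAn1S2 d Lc cΛ') cE cVH cΛ j κ u))
          (fun ρ w => dper M ((symTablesAn1S2 d Lc cΛ').M j ρ w)) ν y') Lc
        (fun κ u => dper M (SpureCombOf (symTablesAn1S2 d Lc cΛ') cE cVH cΛ j κ u)) (fun ρ w => dper M ((symTablesAn1S2 d Lc cΛ').M j ρ w)) μ y)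
      (xbar, Sum.inr m) (zbar, Sum.inr m') = 0 :=
  perF_eq_zero_of_entries M (fun x z => dM_entry_eq_zero_of_tables _ _
    (fun κ u x z => dper_entry_eq_zero M (fun x z => SpureCombOf_an1_inr cΛ' cE cVH cΛ j κ u x z m m') x z)
    (fun ρ w x z => dper_entry_eq_zero M (fun x z => tabsM_an1_left_inr cΛ' j ρ w x z m _) x z) μ y x z) xbar zbar

/-- [folklore] **(L2c) AT an1's RECORD — THE RESPONSE WORD's BORDER IS THE SYMMETRIC TWIN** (`M = Lc·M′`; period invariance by
`CombHId2Torus.dM_dper_translate_inv` at `K′ := K2OfK …` with `CombHId2TorusWords.K2OfK_dper_translate_inv ∕ exists_decays_K2OfK_dper`). -/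
theorem perF_resp_comb_an1_twin (hM : ∀ i, M i = Lc * M' i) (j : ℕ) (μ : Fin (d + 1)) (y : Site (d + 1)) (ν : Fin (d + 1)) (y' : Site (d + 1))
    (xbar zbar : ↥(pbox M)) (α m : Fin (d + 1)) :
    perF M (dM (K2OfK (GcombSh (d := d) Lc j) Lc (fun κ u => dper M (SpureCombOf (symTablesAn1S2 d Lc cΛ') cE cVH cΛ j κ u))
          (fun ρ w => dper M ((symTablesAn1S2 d Lc cΛ').M j ρ w)) ν y') Lc
        (fun κ u => dper M (SpureCombOf (symTablesAn1S2 d Lc cΛ') cE cVH cΛ j κ u)) (fun ρ w => dper M ((symTablesAn1S2 d Lc cΛ').M j ρ w)) μ y)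
      (xbar, Sum.inr m) (zbar, Sum.inl α)
      = perF M (dM (K2OfK (GcombSh (d := d) Lc j) Lc (fun κ u => dper M (SpureCombOf (symTablesAn1S2 d Lc cΛ') cE cVH cΛ j κ u))
          (fun ρ w => dper M ((symTablesAn1S2 d Lc cΛ').M j ρ w)) ν y') Lc
        (fun κ u => dper M (SpureCombOf (symTablesAn1S2 d Lc cΛ') cE cVH cΛ j κ u)) (fun ρ w => dper M ((symTablesAn1S2 d Lc cΛ').M j ρ w)) μ y)
      (zbar, Sum.inl α) (xbar, Sum.inr m) := by
  have hLM : ∀ i, Lc ∣ M i := fun i => ⟨M' i, hM i⟩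
  obtain ⟨δG, CG, hδG, -, hG⟩ := decays_GcombSh (d := d) (Lc := Lc) j
  obtain ⟨CS, δS, hδS, hS⟩ := locStencil_SpureCombOf (symTablesAn1S2 d Lc cΛ') cE cVH cΛ j
  obtain ⟨CM, δM, hδM, hMloc⟩ := (symTablesAn1S2 d Lc cΛ').hM j
  have hSt := periodCov_SpureCombOf M (symTablesAn1S2 d Lc cΛ') cE cVH cΛ hLM j
  have hMt := periodCov_tabsM M (symTablesAn1S2 d Lc cΛ') hM j
  have hK2inv := K2OfK_dper_translate_inv M hM (translate_inv_GcombSh M hLM j) hG hδG hSt hS hδS hMt hMloc hδM ν y'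
  obtain ⟨C₂, δ₂, hδ₂, -, hK2⟩ := exists_decays_K2OfK_dper M hM (translate_inv_GcombSh M hLM j) hG hδG hSt hS hδS hMt hMloc hδM ν y'
  have hXinv := dM_dper_translate_inv M hM hK2inv hK2 hδ₂ hSt hS hδS hMt hMloc hδM μ y
  refine perF_twin_of_twin M hXinv (fun x z => ?_) xbar zbar
  refine dM_twin_of_tables _ _ (fun κ u x z => dper_twin_of_twin M (fun x z => SpureCombOf_an1_twin cΛ' cE cVH cΛ j κ u x z α m) x z)
    (fun ρ w x z => ?_) μ y x z
  rw [dper_entry_eq_zero M (fun x z => tabsM_an1_left_inr cΛ' j ρ w x z m _) x z, dper_entry_eq_zero M (fun x z => tabsM_an1_right_inr cΛ' j ρ w x z _ m) z x]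

/-! ## §5 (L0) The operator's border is the ANTI-twin at the torus: `Â((x̄, inr m),(z̄, inl α)) = −Â((z̄, inl α),(x̄, inr m))`, `Â := perF M (GcombSh Lc j)` -/

omit [∀ μ, NeZero (M μ)] in
/-- [folklore] **(L0) AT THE (III′) RECORD — THE COMB-CHART RESOLVENT's BORDER IS THE ANTISYMMETRIC TWIN ON THE TORUS** (leaf-05's (P0) `Θᴸ = −Θᵀ` by name:
lattice parity `CombChartWardSockets.trK_GcombSh` (`trK G = sgnK G`, `sgnF inl = 1`, `sgnF inr = −1`) + period invariance `CombHId2Record.translate_inv_GcombSh`). -/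
theorem perF_GcombSh_border_antitwin (hLM : ∀ i, Lc ∣ M i) (j : ℕ) (xbar zbar : ↥(pbox M)) (α m : Fin (d + 1)) :
    perF M (GcombSh (d := d) Lc j) (xbar, Sum.inr m) (zbar, Sum.inl α) = -perF M (GcombSh (d := d) Lc j) (zbar, Sum.inl α) (xbar, Sum.inr m) := by
  refine perF_antitwin_of_antitwin M (translate_inv_GcombSh M hLM j) (fun x z => ?_) xbar zbar
  have h := congrFun (congrFun (congrFun (congrFun (trK_GcombSh (d := d) (Lc := Lc) j) z) x) (Sum.inl α)) (Sum.inr m)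
  rw [trK_apply, sgnK_apply, sgnF_inl, sgnF_inr] at h
  rw [h]
  ring

end Record

end Summit.QuantumFields.BalabanUV.Beta.CombHId2TorusTwin

end
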